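import Summits.ResolutionOfSingularities.ResolutionOfSingularities.Theses.FrobeniusLadder
import Summits.ResolutionOfSingularities.ResolutionOfSingularities.Theorems.FrobeniusLadderFInjectiveMacaulayficationAffineBlowupStalkClause
import Summits.ResolutionOfSingularities.ResolutionOfSingularities.Theorems.FrobeniusLadderFInjectiveMacaulayficationAffineBlowupStalkNotClause
import Summits.ResolutionOfSingularities.ResolutionOfSingularities.Theorems.FrobeniusLadderFInjectiveMacaulayficationStrictTransformChartN
import Summits.ResolutionOfSingularities.ResolutionOfSingularities.Theorems.FrobeniusLadderFInjectiveMacaulayficationPrimeTransfer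
import Summits.ResolutionOfSingularities.ResolutionOfSingularities.Theorems.FrobeniusLadderFInjectiveMacaulayficationThreefoldIdentities
import Summits.ResolutionOfSingularities.ResolutionOfSingularities.Theorems.FrobeniusLadderFInjectiveMacaulayficationThreefoldNotDvd
import Summits.ResolutionOfSingularities.ResolutionOfSingularities.Theorems.FrobeniusLadderFInjectiveMacaulayficationThreefoldG3Prime
import Summits.ResolutionOfSingularities.ResolutionOfSingularities.Theorems.FrobeniusLadderFInjectiveMacaulayficationThreefoldOffCentreRegular
import Summits.ResolutionOfSingularities.ResolutionOfSingularities.Theorems.FrobeniusLadderFInjectiveMacaulayficationThreefoldChartsAlongE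
import Summits.ResolutionOfSingularities.ResolutionOfSingularities.Theorems.FrobeniusLadderFInjectiveMacaulayficationThreefoldChart3Points
import Summits.ResolutionOfSingularities.ResolutionOfSingularities.Theorems.FrobeniusLadderFInjectiveMacaulayficationThreefoldChart3OriginSingular
import Summits.ResolutionOfSingularities.ResolutionOfSingularities.Theorems.FrobeniusLadderFInjectiveMacaulayficationThreefoldParameterWitness
import Summits.ResolutionOfSingularities.ResolutionOfSingularities.Theorems.FrobeniusLadderFInjectiveMacaulayficationFiClauseOfRegular
import Summits.ResolutionOfSingularities.ResolutionOfSingularities.Theorems.FrobeniusLadderFInjectiveMacaulayficationDegreeZeroDescent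
import Summits.ResolutionOfSingularities.ResolutionOfSingularities.Theorems.FrobeniusLadderFInjectiveMacaulayficationE8Char5FiModel
import HarnessLib

/-!
# The threefold calibration: the point blow-up F-injectivizes, without resolving, the char-2 germ
# `X₀²X₁ + X₁²X₂ + X₂²X₀ + X₀X₃³ + X₁X₂X₃²` (crux `FInjectiveMacaulayfication`, dimension three)

Support file for crux stmt-ResolutionOfSingularities-15315 (`FrobeniusLadder.FInjectiveMacaulayfication`,
line `Sketch`, lead seat c7, cycle 8): the lead's assembly `stub_threefoldFiModel` of the §13 THREEFOLD
CALIBRATION and, riding along, the route's support item `ThreefoldFInjectiveBlowup`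
(stmt-ResolutionOfSingularities-17936) verbatim — the judge's what_would_move_it for the crux (route rev 3,
2026-08-17): "an explicit blow-up shrinking the Frobenius kernel on `H^d_𝔪` while preserving CM for one
non-F-injective 3-fold germ".

Let `k` be a field of characteristic `2`, `S = k[X₀, X₁, X₂, X₃]`,
`f = X₀²X₁ + X₁²X₂ + X₂²X₀ + X₀X₃³ + X₁X₂X₃²` and `R = S/(f)`: an integral hypersurface (isolated triple point)
which is Cohen–Macaulay but NOT F-injective at the origin (`f ∈ 𝔪^[2]`, Fedder;
`ThreefoldOriginNotClause`, `ThreefoldParameterWitness`). The model is the blow-up of the origin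
`X' = Bl_𝔪 Spec R = affineBlowup 𝔪`, `𝔪 = (x̄₀, …, x̄₃)`, fed through the stalk form E6″
`AffineBlowupStalkClause.stub_affineBlowupStalkClause` of the blow-up glue:

* off `𝔪` the ring `R` is regular (`ThreefoldOffCentreRegular`, Jacobian), hence its local rings are domains
  satisfying the clause (`FiClauseOfRegular`) — `offCentre_fiClause`;
* the chart of the generator `x̄ᵢ` is the hypersurface `S/(gᵢ)` of the strict transform (`θᵢ f = Xᵢ³ gᵢ`,
  `ThreefoldIdentities`; strict-transform presentation `StrictTransformChartN.chart_clause_of_presentationN`),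
  all five forms being prime by ONE computation (`ThreefoldG3Prime`) and the transfer
  `PrimeTransfer.stub_primeTransfer` along the chart substitutions (side conditions `ThreefoldNotDvd`) —
  `forms_prime`;
* along the exceptional divisor, charts `0, 1, 2` are regular (`ThreefoldChartsAlongE`) — `chart_points_clause` —
  and chart `3` passes at every closed point: Jacobian off its origin and FEDDER'S TEST AT ITS ORIGIN
  (`ThreefoldChart3Points`, the Fedder flip `g₃ ∉ (Xᵢ²)`), although that origin is a singular point
  (`ThreefoldChart3OriginSingular`), so `X'` is not regular — `not_isRegular_affineBlowup`.

Hence (`threefoldFiModel`) `X' → Spec R` is proper, birational, not regular, and every stalk of `X'` is a domain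
in which every system of parameters is weakly regular and generates a Frobenius closed ideal: F-injectivization
strictly between Macaulayfication and resolution in dimension `3`, over every field of characteristic `2`
(no perfectness). `threefoldFInjectiveBlowup_proof` packages it with conjunct (a)
(`ThreefoldParameterWitness.stub_threefoldParameterWitness`) as the route decl `ThreefoldFInjectiveBlowup`.

References: R. Fedder, *F-purity and rational singularity*, Trans. AMS 278 (1983), Prop. 1.7, Thm. 1.12
[Fedder1983]; The Stacks Project, Tag 0804 (charts of a blowing up); the computation itself is this
programme's (route FrobeniusLadder, THREEFOLD-CALIBRATION notes of the judge repair 2026-08-17). [folklore]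
-/

-- single-problem summit: the doubled namespace component is forced
set_option linter.dupNamespace false

noncomputable section

namespace Summit.ResolutionOfSingularities.ResolutionOfSingularities.Theorems.FInjectiveMacaulayfication.ThreefoldFiModel

open AlgebraicGeometry CategoryTheory Literature.AlgebraicGeometry.Resolution MvPolynomial
open Summit.ResolutionOfSingularities.ResolutionOfSingularities.Theorems.FInjectiveMacaulayfication

/-! ## The five forms

Throughout, `f` is the germ and `g = ![g₀, g₁, g₂, g₃]` the vector of its strict transforms on the four charts of the
point blow-up (`θᵢ f = Xᵢ³ gᵢ`); both enter as hypotheses `hf`, `hg` (no definitions). -/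

/-- **The forms of the calibration** (over every field): `f ≠ 0`, no variable divides `f`, and for each chart
`i`: the identity `θᵢ f = Xᵢ³ gᵢ`, `Xᵢ ∉ (gᵢ)`, and `(gᵢ)`, `(f)` prime — primality of `g₃` by
`ThreefoldG3Prime`, of `f` by transfer DOWN the `X₃`-chart, of `g₀, g₁, g₂` by transfer UP their charts
(`PrimeTransfer.stub_primeTransfer`, side conditions `ThreefoldNotDvd`). [folklore] -/
theorem forms_prime (k : Type) [Field k] (f : MvPolynomial (Fin 4) k) (g : Fin 4 → MvPolynomial (Fin 4) k)
    (hf : f = MvPolynomial.X 0 ^ 2 * MvPolynomial.X 1 + MvPolynomial.X 1 ^ 2 * MvPolynomial.X 2 + MvPolynomial.X 2 ^ 2 * MvPolynomial.X 0 + MvPolynomial.X 0 * MvPolynomial.X 3 ^ 3 + MvPolynomial.X 1 * MvPolynomial.X 2 * MvPolynomial.X 3 ^ 2)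
    (hg : g = ![MvPolynomial.X 1 + MvPolynomial.X 1 ^ 2 * MvPolynomial.X 2 + MvPolynomial.X 2 ^ 2 + MvPolynomial.X 0 * MvPolynomial.X 3 ^ 3 + MvPolynomial.X 0 * MvPolynomial.X 1 * MvPolynomial.X 2 * MvPolynomial.X 3 ^ 2,
        MvPolynomial.X 0 ^ 2 + MvPolynomial.X 2 + MvPolynomial.X 0 * MvPolynomial.X 2 ^ 2 + MvPolynomial.X 0 * MvPolynomial.X 1 * MvPolynomial.X 3 ^ 3 + MvPolynomial.X 1 * MvPolynomial.X 2 * MvPolynomial.X 3 ^ 2,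
        MvPolynomial.X 0 ^ 2 * MvPolynomial.X 1 + MvPolynomial.X 1 ^ 2 + MvPolynomial.X 0 + MvPolynomial.X 0 * MvPolynomial.X 2 * MvPolynomial.X 3 ^ 3 + MvPolynomial.X 1 * MvPolynomial.X 2 * MvPolynomial.X 3 ^ 2,
        MvPolynomial.X 0 ^ 2 * MvPolynomial.X 1 + MvPolynomial.X 1 ^ 2 * MvPolynomial.X 2 + MvPolynomial.X 2 ^ 2 * MvPolynomial.X 0 + MvPolynomial.X 0 * MvPolynomial.X 3 + MvPolynomial.X 1 * MvPolynomial.X 2 * MvPolynomial.X 3]) :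
    (Ideal.span {f}).IsPrime ∧ f ≠ 0 ∧ (∀ i : Fin 4, (X i : MvPolynomial (Fin 4) k) ∉ Ideal.span {f}) ∧
    ∀ i : Fin 4, (Ideal.span {g i}).IsPrime ∧ (X i : MvPolynomial (Fin 4) k) ∉ Ideal.span {g i} ∧
      MvPolynomial.aeval (fun j : Fin 4 => if j = i then (X i : MvPolynomial (Fin 4) k) else X j * X i) f =
        X i ^ 3 * g i := by
  subst hg
  obtain ⟨hf0, hXf, ⟨hθ0, hX0⟩, ⟨hθ1, hX1⟩, ⟨hθ2, hX2⟩, ⟨hθ3, hX3⟩⟩ :=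
    ThreefoldIdentities.stub_threefoldIdentities k f _ _ _ _ hf rfl rfl rfl rfl
  obtain ⟨hfX, hg0X, hg1X, hg2X, hg3X⟩ :=
    ThreefoldNotDvd.stub_threefoldNotDvd k f _ _ _ _ hf rfl rfl rfl rfl
  have hg3 := ThreefoldG3Prime.stub_threefoldG3Prime k _ rfl
  have hf' : (Ideal.span {f}).IsPrime :=
    (PrimeTransfer.stub_primeTransfer k 4 3 f _ 3 hθ3 (hfX 3) hg3X).mpr hg3
  have hg0 := (PrimeTransfer.stub_primeTransfer k 4 0 f _ 3 hθ0 (hfX 0) hg0X).mp hf'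
  have hg1 := (PrimeTransfer.stub_primeTransfer k 4 1 f _ 3 hθ1 (hfX 1) hg1X).mp hf'
  have hg2 := (PrimeTransfer.stub_primeTransfer k 4 2 f _ 3 hθ2 (hfX 2) hg2X).mp hf'
  refine ⟨hf', hf0, hXf, fun i => ?_⟩
  fin_cases i
  exacts [⟨hg0, hX0, hθ0⟩, ⟨hg1, hX1, hθ1⟩, ⟨hg2, hX2, hθ2⟩, ⟨hg3, hX3, hθ3⟩]

/-! ## The hypotheses of the blow-up glue -/

/-- Off the origin `R = k[X]/(f)` is regular (`ThreefoldOffCentreRegular`), hence its local rings are domains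
satisfying the full stalk clause (`FiClauseOfRegular`). [folklore] -/
theorem offCentre_fiClause (k : Type) [Field k] [CharP k 2] (f : MvPolynomial (Fin 4) k)
    (hf : f = MvPolynomial.X 0 ^ 2 * MvPolynomial.X 1 + MvPolynomial.X 1 ^ 2 * MvPolynomial.X 2 + MvPolynomial.X 2 ^ 2 * MvPolynomial.X 0 + MvPolynomial.X 0 * MvPolynomial.X 3 ^ 3 + MvPolynomial.X 1 * MvPolynomial.X 2 * MvPolynomial.X 3 ^ 2)
    (P : Ideal (MvPolynomial (Fin 4) k ⧸ Ideal.span {f})) [P.IsPrime]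
    (hP : ¬ Ideal.span (Set.range fun j : Fin 4 => Ideal.Quotient.mk (Ideal.span {f}) (X j)) ≤ P) :
    IsDomain (Localization.AtPrime P) ∧
      ∀ d : ℕ, ringKrullDim (Localization.AtPrime P) = d → ∀ s : Fin d → Localization.AtPrime P,
        (Ideal.span (Set.range s)).radical.IsMaximal →
          RingTheory.Sequence.IsWeaklyRegular (Localization.AtPrime P) (List.ofFn s) ∧
          ∀ y : Localization.AtPrime P, (∃ e : ℕ, y ^ 2 ^ e ∈ Ideal.span
            ((fun z : Localization.AtPrime P => z ^ 2 ^ e) ''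
              (Ideal.span (Set.range s) : Set (Localization.AtPrime P)))) → y ∈ Ideal.span (Set.range s) := by
  haveI : Fact (Nat.Prime 2) := ⟨Nat.prime_two⟩
  haveI : IsRegularLocalRing (Localization.AtPrime P) :=
    ThreefoldOffCentreRegular.stub_threefoldOffCentreRegular k f hf P hP
  -- characteristic `2` passes to `R` (a non-trivial `k`-algebra) and to `R_P`
  haveI : Nontrivial (MvPolynomial (Fin 4) k ⧸ Ideal.span {f}) :=
    nontrivial_of_ne (1 : MvPolynomial (Fin 4) k ⧸ Ideal.span {f}) 0 fun h10 =>
      Ideal.IsPrime.ne_top ‹P.IsPrime› ((Ideal.eq_top_iff_one P).mpr (by rw [h10]; exact P.zero_mem))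
  haveI : CharP (MvPolynomial (Fin 4) k ⧸ Ideal.span {f}) 2 :=
    charP_of_injective_algebraMap (algebraMap k (MvPolynomial (Fin 4) k ⧸ Ideal.span {f})).injective 2
  haveI : CharP (Localization.AtPrime P) 2 := DegreeZeroDescent.charP_localization_atPrime 2 P
  have key := FiClauseOfRegular.stub_fiClauseOfRegular 2 (Localization.AtPrime P)
  exact key

/-- Along the exceptional divisor the charts `0, 1, 2` satisfy the clause at every closed point: they are
regular there (`ThreefoldChartsAlongE`), and regular local rings of characteristic `2` satisfy the clause
(`ThreefoldChart3Points.clause_of_pderiv_notMem` packages the Jacobian route; here we go through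
`IsRegularLocalRing` directly). [folklore] -/
theorem clause_of_isRegular (k : Type) [Field k] [CharP k 2] (g : MvPolynomial (Fin 4) k)
    (Q : Ideal (MvPolynomial (Fin 4) k ⧸ Ideal.span {g})) [Q.IsMaximal]
    (hreg : IsRegularLocalRing (Localization.AtPrime Q)) :
    ∀ d : ℕ, ringKrullDim (Localization.AtPrime Q) = d → ∀ s : Fin d → Localization.AtPrime Q,
      (Ideal.span (Set.range s)).radical.IsMaximal →
        RingTheory.Sequence.IsWeaklyRegular (Localization.AtPrime Q) (List.ofFn s) ∧
        ∀ y : Localization.AtPrime Q, (∃ e : ℕ, y ^ 2 ^ e ∈ Ideal.span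
          ((fun z : Localization.AtPrime Q => z ^ 2 ^ e) ''
            (Ideal.span (Set.range s) : Set (Localization.AtPrime Q)))) → y ∈ Ideal.span (Set.range s) := by
  haveI : Fact (Nat.Prime 2) := ⟨Nat.prime_two⟩
  haveI := hreg
  haveI : Nontrivial (MvPolynomial (Fin 4) k ⧸ Ideal.span {g}) :=
    nontrivial_of_ne (1 : MvPolynomial (Fin 4) k ⧸ Ideal.span {g}) 0 fun h10 =>
      Ideal.IsMaximal.ne_top ‹_› ((Ideal.eq_top_iff_one Q).mpr (by rw [h10]; exact Q.zero_mem))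
  haveI : CharP (MvPolynomial (Fin 4) k ⧸ Ideal.span {g}) 2 :=
    charP_of_injective_algebraMap (algebraMap k (MvPolynomial (Fin 4) k ⧸ Ideal.span {g})).injective 2
  haveI : CharP (Localization.AtPrime Q) 2 := DegreeZeroDescent.charP_localization_atPrime 2 Q
  have key := (FiClauseOfRegular.stub_fiClauseOfRegular 2 (Localization.AtPrime Q)).2
  exact key

/-- The clause at the closed points of the exceptional divisor, chart by chart (`i : Fin 4`), in the
hypersurface presentation `k[X]/(gᵢ)`: charts `0, 1, 2` by regularity (`ThreefoldChartsAlongE`), chart `3` by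
the Fedder flip (`ThreefoldChart3Points`). [folklore] -/
theorem chart_points_clause (k : Type) [Field k] [CharP k 2] (g : Fin 4 → MvPolynomial (Fin 4) k)
    (hg : g = ![MvPolynomial.X 1 + MvPolynomial.X 1 ^ 2 * MvPolynomial.X 2 + MvPolynomial.X 2 ^ 2 + MvPolynomial.X 0 * MvPolynomial.X 3 ^ 3 + MvPolynomial.X 0 * MvPolynomial.X 1 * MvPolynomial.X 2 * MvPolynomial.X 3 ^ 2,
        MvPolynomial.X 0 ^ 2 + MvPolynomial.X 2 + MvPolynomial.X 0 * MvPolynomial.X 2 ^ 2 + MvPolynomial.X 0 * MvPolynomial.X 1 * MvPolynomial.X 3 ^ 3 + MvPolynomial.X 1 * MvPolynomial.X 2 * MvPolynomial.X 3 ^ 2,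
        MvPolynomial.X 0 ^ 2 * MvPolynomial.X 1 + MvPolynomial.X 1 ^ 2 + MvPolynomial.X 0 + MvPolynomial.X 0 * MvPolynomial.X 2 * MvPolynomial.X 3 ^ 3 + MvPolynomial.X 1 * MvPolynomial.X 2 * MvPolynomial.X 3 ^ 2,
        MvPolynomial.X 0 ^ 2 * MvPolynomial.X 1 + MvPolynomial.X 1 ^ 2 * MvPolynomial.X 2 + MvPolynomial.X 2 ^ 2 * MvPolynomial.X 0 + MvPolynomial.X 0 * MvPolynomial.X 3 + MvPolynomial.X 1 * MvPolynomial.X 2 * MvPolynomial.X 3])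
    (i : Fin 4) (Q : Ideal (MvPolynomial (Fin 4) k ⧸ Ideal.span {g i})) [Q.IsMaximal]
    (hQ : Ideal.Quotient.mk (Ideal.span {g i}) (X i) ∈ Q) :
    ∀ d : ℕ, ringKrullDim (Localization.AtPrime Q) = d → ∀ s : Fin d → Localization.AtPrime Q,
      (Ideal.span (Set.range s)).radical.IsMaximal →
        RingTheory.Sequence.IsWeaklyRegular (Localization.AtPrime Q) (List.ofFn s) ∧
        ∀ y : Localization.AtPrime Q, (∃ e : ℕ, y ^ 2 ^ e ∈ Ideal.span
          ((fun z : Localization.AtPrime Q => z ^ 2 ^ e) ''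
            (Ideal.span (Set.range s) : Set (Localization.AtPrime Q)))) → y ∈ Ideal.span (Set.range s) := by
  have hg0 : g 0 = X 1 + X 1 ^ 2 * X 2 + X 2 ^ 2 + X 0 * X 3 ^ 3 + X 0 * X 1 * X 2 * X 3 ^ 2 := by
    rw [hg]; rfl
  have hg1 : g 1 = X 0 ^ 2 + X 2 + X 0 * X 2 ^ 2 + X 0 * X 1 * X 3 ^ 3 + X 1 * X 2 * X 3 ^ 2 := by
    rw [hg]; rfl
  have hg2 : g 2 = X 0 ^ 2 * X 1 + X 1 ^ 2 + X 0 + X 0 * X 2 * X 3 ^ 3 + X 1 * X 2 * X 3 ^ 2 := by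
    rw [hg]; rfl
  have hg3 : g 3 = X 0 ^ 2 * X 1 + X 1 ^ 2 * X 2 + X 2 ^ 2 * X 0 + X 0 * X 3 + X 1 * X 2 * X 3 := by
    rw [hg]; rfl
  obtain ⟨h0, h1, h2⟩ := ThreefoldChartsAlongE.stub_threefoldChartsAlongE k (g 0) (g 1) (g 2) hg0 hg1 hg2
  have c0 : ∀ (Q : Ideal (MvPolynomial (Fin 4) k ⧸ Ideal.span {g 0})) [Q.IsMaximal],
      Ideal.Quotient.mk (Ideal.span {g 0}) (X 0) ∈ Q →
      ∀ d : ℕ, ringKrullDim (Localization.AtPrime Q) = d → ∀ s : Fin d → Localization.AtPrime Q,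
        (Ideal.span (Set.range s)).radical.IsMaximal →
          RingTheory.Sequence.IsWeaklyRegular (Localization.AtPrime Q) (List.ofFn s) ∧
          ∀ y : Localization.AtPrime Q, (∃ e : ℕ, y ^ 2 ^ e ∈ Ideal.span
            ((fun z : Localization.AtPrime Q => z ^ 2 ^ e) ''
              (Ideal.span (Set.range s) : Set (Localization.AtPrime Q)))) → y ∈ Ideal.span (Set.range s) :=
    fun Q _ hQ => clause_of_isRegular k _ Q (h0 Q hQ)
  have c1 : ∀ (Q : Ideal (MvPolynomial (Fin 4) k ⧸ Ideal.span {g 1})) [Q.IsMaximal],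
      Ideal.Quotient.mk (Ideal.span {g 1}) (X 1) ∈ Q →
      ∀ d : ℕ, ringKrullDim (Localization.AtPrime Q) = d → ∀ s : Fin d → Localization.AtPrime Q,
        (Ideal.span (Set.range s)).radical.IsMaximal →
          RingTheory.Sequence.IsWeaklyRegular (Localization.AtPrime Q) (List.ofFn s) ∧
          ∀ y : Localization.AtPrime Q, (∃ e : ℕ, y ^ 2 ^ e ∈ Ideal.span
            ((fun z : Localization.AtPrime Q => z ^ 2 ^ e) ''
              (Ideal.span (Set.range s) : Set (Localization.AtPrime Q)))) → y ∈ Ideal.span (Set.range s) :=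
    fun Q _ hQ => clause_of_isRegular k _ Q (h1 Q hQ)
  have c2 : ∀ (Q : Ideal (MvPolynomial (Fin 4) k ⧸ Ideal.span {g 2})) [Q.IsMaximal],
      Ideal.Quotient.mk (Ideal.span {g 2}) (X 2) ∈ Q →
      ∀ d : ℕ, ringKrullDim (Localization.AtPrime Q) = d → ∀ s : Fin d → Localization.AtPrime Q,
        (Ideal.span (Set.range s)).radical.IsMaximal →
          RingTheory.Sequence.IsWeaklyRegular (Localization.AtPrime Q) (List.ofFn s) ∧
          ∀ y : Localization.AtPrime Q, (∃ e : ℕ, y ^ 2 ^ e ∈ Ideal.span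
            ((fun z : Localization.AtPrime Q => z ^ 2 ^ e) ''
              (Ideal.span (Set.range s) : Set (Localization.AtPrime Q)))) → y ∈ Ideal.span (Set.range s) :=
    fun Q _ hQ => clause_of_isRegular k _ Q (h2 Q hQ)
  have c3 := ThreefoldChart3Points.stub_threefoldChart3Points k (g 3) hg3
  revert hQ Q
  fin_cases i
  exacts [c0, c1, c2, c3]

/-! ## The model is not regular -/

/-- **The blow-up of the origin of the threefold is NOT regular**: the origin of the `X₃`-chart
`k[X]/(g₃)` is a singular point (`ThreefoldChart3OriginSingular`), and it is a stalk of `affineBlowup 𝔪`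
(strict-transform presentation `StrictTransformChartN` + `AffineBlowupStalkNotClause.nonempty_stalkAwayιEquiv`).
[folklore] -/
theorem not_isRegular_affineBlowup (k : Type) [Field k] (f : MvPolynomial (Fin 4) k) (g : Fin 4 → MvPolynomial (Fin 4) k)
    (hf : f = MvPolynomial.X 0 ^ 2 * MvPolynomial.X 1 + MvPolynomial.X 1 ^ 2 * MvPolynomial.X 2 + MvPolynomial.X 2 ^ 2 * MvPolynomial.X 0 + MvPolynomial.X 0 * MvPolynomial.X 3 ^ 3 + MvPolynomial.X 1 * MvPolynomial.X 2 * MvPolynomial.X 3 ^ 2)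
    (hg : g = ![MvPolynomial.X 1 + MvPolynomial.X 1 ^ 2 * MvPolynomial.X 2 + MvPolynomial.X 2 ^ 2 + MvPolynomial.X 0 * MvPolynomial.X 3 ^ 3 + MvPolynomial.X 0 * MvPolynomial.X 1 * MvPolynomial.X 2 * MvPolynomial.X 3 ^ 2,
        MvPolynomial.X 0 ^ 2 + MvPolynomial.X 2 + MvPolynomial.X 0 * MvPolynomial.X 2 ^ 2 + MvPolynomial.X 0 * MvPolynomial.X 1 * MvPolynomial.X 3 ^ 3 + MvPolynomial.X 1 * MvPolynomial.X 2 * MvPolynomial.X 3 ^ 2,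
        MvPolynomial.X 0 ^ 2 * MvPolynomial.X 1 + MvPolynomial.X 1 ^ 2 + MvPolynomial.X 0 + MvPolynomial.X 0 * MvPolynomial.X 2 * MvPolynomial.X 3 ^ 3 + MvPolynomial.X 1 * MvPolynomial.X 2 * MvPolynomial.X 3 ^ 2,
        MvPolynomial.X 0 ^ 2 * MvPolynomial.X 1 + MvPolynomial.X 1 ^ 2 * MvPolynomial.X 2 + MvPolynomial.X 2 ^ 2 * MvPolynomial.X 0 + MvPolynomial.X 0 * MvPolynomial.X 3 + MvPolynomial.X 1 * MvPolynomial.X 2 * MvPolynomial.X 3])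
    (x : Fin 4 → MvPolynomial (Fin 4) k ⧸ Ideal.span {f})
    (hx : x = fun j : Fin 4 => Ideal.Quotient.mk (Ideal.span {f}) (X j)) :
    ¬ Scheme.IsRegular (affineBlowup (Ideal.span (Set.range x))) := by
  intro hreg
  obtain ⟨hfprime, hf0, -, hcharts⟩ := forms_prime k f g hf hg
  obtain ⟨hg3, hX3, hθ3⟩ := hcharts 3
  obtain ⟨e, -⟩ := StrictTransformChartN.stub_strictTransformChartN k 4 f (g 3) 3 3 hfprime hf0 hg3 hX3 hθ3 x hx
  -- the origin of the chart `k[X]/(g₃)`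
  have hg3eq : g 3 = X 0 ^ 2 * X 1 + X 1 ^ 2 * X 2 + X 2 ^ 2 * X 0 + X 0 * X 3 + X 1 * X 2 * X 3 := by
    rw [hg]
    rfl
  have hker : RingHom.ker (Ideal.Quotient.mk (Ideal.span {g 3})) ≤
      Ideal.span (Set.range (X : Fin 4 → MvPolynomial (Fin 4) k)) := by
    rw [Ideal.mk_ker, Ideal.span_singleton_le_iff_mem, hg3eq]
    exact (ThreefoldChart3Points.g3_mem_and_ne_zero k).1
  haveI := Fedder.isMaximal_span_range_X k 4
  obtain ⟨hQmax, hQcomap⟩ := BlowupFiModel.isMaximal_map_and_comap_map_of_surjective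
    (Ideal.Quotient.mk (Ideal.span {g 3})) Ideal.Quotient.mk_surjective
    (Ideal.span (Set.range (X : Fin 4 → MvPolynomial (Fin 4) k))) hker
  set Q := Ideal.map (Ideal.Quotient.mk (Ideal.span {g 3}))
    (Ideal.span (Set.range (X : Fin 4 → MvPolynomial (Fin 4) k))) with hQdef
  haveI := hQmax
  -- its image `Q'` in the chart ring, and the corresponding point `y` of the blow-up
  set Q' : Ideal (HomogeneousLocalization.Away (reesGrading (Ideal.span (Set.range x)))
      (reesT (x 3) (Ideal.subset_span (Set.mem_range_self 3)))) := Q.map e with hQ'def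
  haveI hQ'prime : Q'.IsPrime := Ideal.map_isPrime_of_equiv e
  have hQ'Q : Q'.comap e.toRingHom = Q := by
    have h : (Q.map e).comap e = Q := Ideal.comap_map_of_bijective e e.bijective
    ext b
    rw [← h]
    simp only [Ideal.mem_comap, RingEquiv.toRingHom_eq_coe, RingHom.coe_coe, hQ'def]
  let q : PrimeSpectrum (HomogeneousLocalization.Away (reesGrading (Ideal.span (Set.range x)))
      (reesT (x 3) (Ideal.subset_span (Set.mem_range_self 3)))) := ⟨Q', hQ'prime⟩
  obtain ⟨e₁⟩ := AffineBlowupStalkNotClause.nonempty_stalkAwayιEquiv (I := Ideal.span (Set.range x)) (x 3)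
    (Ideal.subset_span (Set.mem_range_self 3)) q
  obtain ⟨e₂⟩ := E8Char5FiModel.nonempty_ringEquiv_localization_comap e Q'
  -- the singular chart origin
  have hnot : ¬ IsRegularLocalRing (Localization.AtPrime (Q'.comap e.toRingHom)) := by
    haveI : (Q'.comap e.toRingHom).IsPrime := Ideal.comap_isPrime _ _
    refine ThreefoldChart3OriginSingular.stub_threefoldChart3OriginSingular k (g 3) hg3eq _ ?_
    rw [hQ'Q]
    exact hQcomap
  apply hnot
  haveI : IsRegularLocalRing ((affineBlowup (Ideal.span (Set.range x))).presheaf.stalk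
      ((Proj.awayι (reesGrading (Ideal.span (Set.range x))) (reesT (x 3) (Ideal.subset_span (Set.mem_range_self 3)))
        (reesT_mem (x 3) _) Nat.one_pos).base q)) := hreg _
  exact IsRegularLocalRing.of_ringEquiv (e₁.trans e₂.symm)

/-! ## The model -/

-- budget: four chart presentations, each compared against the chart-ring types of `affineBlowup` (≈ 3× default)
set_option maxHeartbeats 800000 in
/-- **THE THREEFOLD CALIBRATION** (see the module docstring): for every field `k` of characteristic `2` the
blow-up of the origin of `Spec k[X₀..X₃]/(X₀²X₁+X₁²X₂+X₂²X₀+X₀X₃³+X₁X₂X₃²)` is proper, birational, NOT regular,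
and all its stalks are domains with every system of parameters weakly regular and every parameter ideal
Frobenius closed. [folklore] -/
theorem threefoldFiModel (k : Type) [Field k] [CharP k 2] (f : MvPolynomial (Fin 4) k)
    (hf : f = MvPolynomial.X 0 ^ 2 * MvPolynomial.X 1 + MvPolynomial.X 1 ^ 2 * MvPolynomial.X 2 + MvPolynomial.X 2 ^ 2 * MvPolynomial.X 0 + MvPolynomial.X 0 * MvPolynomial.X 3 ^ 3 + MvPolynomial.X 1 * MvPolynomial.X 2 * MvPolynomial.X 3 ^ 2) :
    ∃ (X' : Scheme.{0}) (π : X' ⟶ Spec (.of (MvPolynomial (Fin 4) k ⧸ Ideal.span {f}))), IsProper π ∧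
      Literature.AlgebraicGeometry.Resolution.IsBirational π ∧
      ¬ Literature.AlgebraicGeometry.Resolution.Scheme.IsRegular X' ∧
      ∀ y : X', IsDomain (X'.presheaf.stalk y) ∧ ∀ d : ℕ, ringKrullDim (X'.presheaf.stalk y) = d →
        ∀ s : Fin d → X'.presheaf.stalk y, (Ideal.span (Set.range s)).radical.IsMaximal →
          RingTheory.Sequence.IsWeaklyRegular (X'.presheaf.stalk y) (List.ofFn s) ∧
          ∀ z : X'.presheaf.stalk y, (∃ e : ℕ, z ^ 2 ^ e ∈
              Ideal.span ((fun w : X'.presheaf.stalk y => w ^ 2 ^ e) ''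
                (Ideal.span (Set.range s) : Set (X'.presheaf.stalk y)))) →
            z ∈ Ideal.span (Set.range s) := by
  haveI : Fact (Nat.Prime 2) := ⟨Nat.prime_two⟩
  obtain ⟨g, hg⟩ : ∃ g : Fin 4 → MvPolynomial (Fin 4) k, g = ![MvPolynomial.X 1 + MvPolynomial.X 1 ^ 2 * MvPolynomial.X 2 + MvPolynomial.X 2 ^ 2 + MvPolynomial.X 0 * MvPolynomial.X 3 ^ 3 + MvPolynomial.X 0 * MvPolynomial.X 1 * MvPolynomial.X 2 * MvPolynomial.X 3 ^ 2,
        MvPolynomial.X 0 ^ 2 + MvPolynomial.X 2 + MvPolynomial.X 0 * MvPolynomial.X 2 ^ 2 + MvPolynomial.X 0 * MvPolynomial.X 1 * MvPolynomial.X 3 ^ 3 + MvPolynomial.X 1 * MvPolynomial.X 2 * MvPolynomial.X 3 ^ 2,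
        MvPolynomial.X 0 ^ 2 * MvPolynomial.X 1 + MvPolynomial.X 1 ^ 2 + MvPolynomial.X 0 + MvPolynomial.X 0 * MvPolynomial.X 2 * MvPolynomial.X 3 ^ 3 + MvPolynomial.X 1 * MvPolynomial.X 2 * MvPolynomial.X 3 ^ 2,
        MvPolynomial.X 0 ^ 2 * MvPolynomial.X 1 + MvPolynomial.X 1 ^ 2 * MvPolynomial.X 2 + MvPolynomial.X 2 ^ 2 * MvPolynomial.X 0 + MvPolynomial.X 0 * MvPolynomial.X 3 + MvPolynomial.X 1 * MvPolynomial.X 2 * MvPolynomial.X 3] := ⟨_, rfl⟩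
  obtain ⟨hfprime, hf0, hXf, hcharts⟩ := forms_prime k f g hf hg
  haveI := hfprime
  -- `R = k[X]/(f)` is a Noetherian domain of characteristic 2
  haveI : IsDomain (MvPolynomial (Fin 4) k ⧸ Ideal.span {f}) := Ideal.Quotient.isDomain _
  haveI : CharP (MvPolynomial (Fin 4) k ⧸ Ideal.span {f}) 2 :=
    charP_of_injective_algebraMap (algebraMap k (MvPolynomial (Fin 4) k ⧸ Ideal.span {f})).injective 2
  -- the centre `𝔪 = (x̄₀, …, x̄₃) ≠ 0`
  obtain ⟨x, hx⟩ : ∃ x : Fin 4 → MvPolynomial (Fin 4) k ⧸ Ideal.span {f},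
      x = fun j : Fin 4 => Ideal.Quotient.mk (Ideal.span {f}) (X j) := ⟨_, rfl⟩
  have hxne : ∀ i : Fin 4, x i ≠ 0 := fun i h => by
    rw [hx] at h
    exact hXf i (Ideal.Quotient.eq_zero_iff_mem.mp h)
  have hI : Ideal.span (Set.range x) ≠ ⊥ := fun hbot =>
    hxne 0 ((Ideal.mem_bot).mp (hbot ▸ Ideal.subset_span (Set.mem_range_self 0)))
  refine ⟨affineBlowup (Ideal.span (Set.range x)), affineBlowup.π (Ideal.span (Set.range x)), inferInstance,
    affineBlowup.isBirational hI, not_isRegular_affineBlowup k f g hf hg x hx, ?_⟩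
  refine AffineBlowupStalkClause.stub_affineBlowupStalkClause 2 (MvPolynomial (Fin 4) k ⧸ Ideal.span {f})
    (Ideal.span (Set.range x)) 4 x (fun i => Ideal.subset_span (Set.mem_range_self i)) rfl hI ?_ ?_
  · -- off the origin `R_P` is regular, hence satisfies the clause
    intro P _ hP
    have hP' : ¬ Ideal.span (Set.range fun j : Fin 4 =>
        Ideal.Quotient.mk (Ideal.span {f}) (X j)) ≤ P := by rwa [← hx]
    exact offCentre_fiClause k f hf P hP'
  · -- on the exceptional divisor, chart by chart, through the strict-transform presentation
    intro i _ Q hQ huQ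
    obtain ⟨hgi, hXg, hθ⟩ := hcharts i
    have key := StrictTransformChartN.chart_clause_of_presentationN 2 k 4 f hfprime hf0 x hx i (g i) 3 hgi
      hXg hθ (fun Q' _ hQ' => chart_points_clause k g hg i Q' hQ') Q huQ
    exact key

/-- **Registered form** (lead stub `stub_threefoldFiModel` of crux stmt-ResolutionOfSingularities-15315, line
`Sketch`, §13) — `= threefoldFiModel`. [folklore] -/
theorem stub_threefoldFiModel : ∀ (k : Type) [Field k] [CharP k 2] (f : MvPolynomial (Fin 4) k),
    f = MvPolynomial.X 0 ^ 2 * MvPolynomial.X 1 + MvPolynomial.X 1 ^ 2 * MvPolynomial.X 2 + MvPolynomial.X 2 ^ 2 * MvPolynomial.X 0 + MvPolynomial.X 0 * MvPolynomial.X 3 ^ 3 + MvPolynomial.X 1 * MvPolynomial.X 2 * MvPolynomial.X 3 ^ 2 →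
    ∃ (X' : Scheme.{0}) (π : X' ⟶ Spec (.of (MvPolynomial (Fin 4) k ⧸ Ideal.span {f}))), IsProper π ∧
      Literature.AlgebraicGeometry.Resolution.IsBirational π ∧
      ¬ Literature.AlgebraicGeometry.Resolution.Scheme.IsRegular X' ∧
      ∀ y : X', IsDomain (X'.presheaf.stalk y) ∧ ∀ d : ℕ, ringKrullDim (X'.presheaf.stalk y) = d →
        ∀ s : Fin d → X'.presheaf.stalk y, (Ideal.span (Set.range s)).radical.IsMaximal →
          RingTheory.Sequence.IsWeaklyRegular (X'.presheaf.stalk y) (List.ofFn s) ∧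
          ∀ z : X'.presheaf.stalk y, (∃ e : ℕ, z ^ 2 ^ e ∈
              Ideal.span ((fun w : X'.presheaf.stalk y => w ^ 2 ^ e) ''
                (Ideal.span (Set.range s) : Set (X'.presheaf.stalk y)))) →
            z ∈ Ideal.span (Set.range s) := by
  intro k _ _ f hf
  exact threefoldFiModel k f hf

/-- **THE ROUTE'S SUPPORT ITEM `ThreefoldFInjectiveBlowup` (stmt-ResolutionOfSingularities-17936), verbatim**:
conjunct (a) — the parameter ideal `(x̄₀+x̄₁, x̄₂, x̄₃)` of the origin is not Frobenius closed, witness `x̄₀²`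
(`ThreefoldParameterWitness.stub_threefoldParameterWitness`); conjunct (b) — the F-injective, non-regular
proper birational model (`stub_threefoldFiModel`). The judge's what_would_move_it for crux
`FInjectiveMacaulayfication` (route rev 3), kernel-checked. [folklore] -/
theorem threefoldFInjectiveBlowup_proof :
    Summit.ResolutionOfSingularities.ResolutionOfSingularities.Theses.FrobeniusLadder.ThreefoldFInjectiveBlowup := by
  intro k _ _ f A u I
  exact ⟨ThreefoldParameterWitness.stub_threefoldParameterWitness k f rfl u rfl, stub_threefoldFiModel k f rfl⟩

end Summit.ResolutionOfSingularities.ResolutionOfSingularities.Theorems.FInjectiveMacaulayfication.ThreefoldFiModel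

end
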